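import Literature.Analysis.Complex.PickFunctionsProofs
import Literature.Analysis.Complex.Montel

/-!
# Pick continuations from locally bounded Pick approximants (Montel endgame for Loewner, Part I)

Support file for the discharge of `Literature.Analysis.Complex.loewner_theorem`, Part I
(monotone matrix function ⇒ Pick continuation across the interval).  Every classical proof of
Part I ends with a normal-family step: one produces explicit Pick functions `g_k` (rational, or with
known integral representation), holomorphic on the slit domain `{Im z ≠ 0 ∨ Re z ∈ Δ}` and locally
bounded there, which converge to `f` at the points of a dense subset of `Δ`; Montel's theorem then
gives a locally uniform subsequential limit `G`, holomorphic on the slit domain, with `Im G ≥ 0` on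
`Π`, and `G = f` on `Δ` by continuity of `f` (Sparr, *Math. Scand.* 47 (1980); Hansen–Pedersen,
*Math. Ann.* 258 (1982), §4; Donoghue, *Monotone Matrix Functions and Analytic Continuation*
(1974)).

* `exists_pick_continuation_of_tendsto` — this endgame, from Montel's theorem as proved in
  `Literature/Analysis/Complex/Montel.lean`
  (`Complex.exists_strictMono_tendstoLocallyUniformlyOn_deriv`).
* `exists_bound_atom_of_isCompact`, `locallyBounded_of_atom_bound` — the atoms `z/(1 - λ z)`,
  `|λ| ≤ 1`, are bounded on compact subsets of the slit domain of `(-1,1)` uniformly in `λ`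
  (local boundedness of the Hansen–Pedersen / Loewner approximants `a + b ∑ cᵢ z/(1 - λᵢ z)`).

No definitions, no named facts; everything is folklore.
-/

noncomputable section

open Set Filter Topology Metric
open _root_.Complex

namespace Literature.Analysis.Complex

/-! ### The Montel endgame -/

/-- **Pick continuation from locally bounded Pick approximants.** Let `Δ ⊆ ℝ` be open and
`U = {Im z ≠ 0 ∨ Re z ∈ Δ}` its slit domain. If `g k` are holomorphic on `U`, locally bounded on
`U` uniformly in `k`, with `Im (g k) ≥ 0` on `Π`, and `g k x → f x` for `x` in a subset `D ⊆ Δ`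
dense in `Δ`, where `f` is continuous on `Δ`, then `f = G|Δ` for some `G` holomorphic on `U` with
`Im G ≥ 0` on `Π` (Montel's theorem and continuity). [folklore] -/
theorem exists_pick_continuation_of_tendsto {Δ D : Set ℝ} (hΔ : IsOpen Δ) (hDΔ : D ⊆ Δ)
    (hdense : Δ ⊆ closure D) {f : ℝ → ℝ} (hf : ContinuousOn f Δ) {g : ℕ → ℂ → ℂ}
    (hg : ∀ k, DifferentiableOn ℂ (g k) {z : ℂ | z.im ≠ 0 ∨ z.re ∈ Δ})
    (hb : ∀ a ∈ {z : ℂ | z.im ≠ 0 ∨ z.re ∈ Δ}, ∃ M : ℝ, ∃ r > 0, ∀ k,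
      ∀ z ∈ ball a r ∩ {z : ℂ | z.im ≠ 0 ∨ z.re ∈ Δ}, ‖g k z‖ ≤ M)
    (hpos : ∀ k, ∀ z : ℂ, 0 < z.im → 0 ≤ (g k z).im)
    (hlim : ∀ x ∈ D, Tendsto (fun k => g k x) atTop (𝓝 (f x))) :
    ∃ G : ℂ → ℂ, DifferentiableOn ℂ G {z : ℂ | z.im ≠ 0 ∨ z.re ∈ Δ} ∧
      (∀ z : ℂ, 0 < z.im → 0 ≤ (G z).im) ∧ ∀ x ∈ Δ, G x = f x := by
  set U : Set ℂ := {z : ℂ | z.im ≠ 0 ∨ z.re ∈ Δ} with hU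
  have hUo : IsOpen U := isOpen_pickDomain hΔ
  obtain ⟨G, φ, hφ, hGd, hGlim, -⟩ :=
    Complex.exists_strictMono_tendstoLocallyUniformlyOn_deriv hUo hg hb
  refine ⟨G, hGd, ?_, ?_⟩
  · -- `Im G ≥ 0` on `Π`: pointwise limit of nonnegative numbers
    intro z hz
    have hzU : z ∈ U := Or.inl hz.ne'
    have ht : Tendsto (fun k => (g (φ k) z).im) atTop (𝓝 (G z).im) :=
      (Complex.continuous_im.tendsto _).comp (hGlim.tendsto_at hzU)
    exact ge_of_tendsto' ht fun k => hpos _ z hz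
  · -- `G = f` on `D`, then on `Δ` by continuity
    have hD : ∀ x ∈ D, G x = f x := by
      intro x hx
      have hxU : (x : ℂ) ∈ U := Or.inr (by simpa using hDΔ hx)
      have h1 : Tendsto (fun k => g (φ k) x) atTop (𝓝 (G x)) := hGlim.tendsto_at hxU
      have h2 : Tendsto (fun k => g (φ k) x) atTop (𝓝 (f x)) :=
        (hlim x hx).comp hφ.tendsto_atTop
      exact tendsto_nhds_unique h1 h2
    intro x hx
    -- both sides are continuous functions of `x ∈ Δ`
    have hGc : ContinuousOn (fun t : ℝ => G t) Δ := by
      refine (hGd.continuousOn.comp Complex.continuous_ofReal.continuousOn ?_)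
      intro t ht
      exact Or.inr (by simpa using ht)
    have hfc : ContinuousOn (fun t : ℝ => ((f t : ℝ) : ℂ)) Δ :=
      Complex.continuous_ofReal.comp_continuousOn hf
    -- closeness argument at `x`
    have key : ∀ ε > 0, ‖G x - f x‖ < ε := by
      intro ε hε
      have h1 := Metric.continuousWithinAt_iff.mp (hGc x hx) (ε / 2) (by positivity)
      have h2 := Metric.continuousWithinAt_iff.mp (hfc x hx) (ε / 2) (by positivity)
      obtain ⟨δ₁, hδ₁, hδ₁'⟩ := h1
      obtain ⟨δ₂, hδ₂, hδ₂'⟩ := h2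
      have hxD : x ∈ closure D := hdense hx
      obtain ⟨y, hyD, hyx⟩ := Metric.mem_closure_iff.mp hxD (min δ₁ δ₂) (lt_min hδ₁ hδ₂)
      have hyΔ : y ∈ Δ := hDΔ hyD
      have hy1 : dist y x < δ₁ := by rw [dist_comm]; exact lt_of_lt_of_le hyx (min_le_left _ _)
      have hy2 : dist y x < δ₂ := by rw [dist_comm]; exact lt_of_lt_of_le hyx (min_le_right _ _)
      have e1 : dist (G y) (G x) < ε / 2 := hδ₁' hyΔ hy1
      have e2 : dist ((f y : ℝ) : ℂ) ((f x : ℝ) : ℂ) < ε / 2 := hδ₂' hyΔ hy2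
      rw [hD y hyD] at e1
      calc ‖G x - f x‖ = dist (G ↑x) ((f x : ℝ) : ℂ) := by rw [dist_eq_norm]
        _ ≤ dist (G ↑x) ((f y : ℝ) : ℂ) + dist ((f y : ℝ) : ℂ) ((f x : ℝ) : ℂ) :=
          dist_triangle _ _ _
        _ < ε / 2 + ε / 2 := by rw [dist_comm] at e1; exact add_lt_add e1 e2
        _ = ε := by ring
    have : ‖G x - f x‖ = 0 := by
      by_contra h
      have hpos' : 0 < ‖G x - f x‖ := lt_of_le_of_ne (norm_nonneg _) (Ne.symm h)
      exact lt_irrefl _ (key _ hpos')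
    exact sub_eq_zero.mp (norm_eq_zero.mp this)

/-- **Pick continuation from locally bounded Pick approximants, monotone version.** As
`exists_pick_continuation_of_tendsto`, but with continuity of `f` on `Δ` replaced by
monotonicity: if `f` is monotone on the open set `Δ` and the approximants converge to `f` on a
subset `D` dense in `Δ`, the locally uniform limit `G` still satisfies `G = f` on all of `Δ`
(a monotone function squeezed between the values of the continuous function `G` on a dense set has
no jumps). This is the form used for Loewner's theorem, where the continuity of a matrix monotone
function is not known a priori. [folklore] -/
theorem exists_pick_continuation_of_tendsto_of_monotoneOn {Δ D : Set ℝ} (hΔ : IsOpen Δ)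
    (hDΔ : D ⊆ Δ) (hdense : Δ ⊆ closure D) {f : ℝ → ℝ} (hf : MonotoneOn f Δ) {g : ℕ → ℂ → ℂ}
    (hg : ∀ k, DifferentiableOn ℂ (g k) {z : ℂ | z.im ≠ 0 ∨ z.re ∈ Δ})
    (hb : ∀ a ∈ {z : ℂ | z.im ≠ 0 ∨ z.re ∈ Δ}, ∃ M : ℝ, ∃ r > 0, ∀ k,
      ∀ z ∈ ball a r ∩ {z : ℂ | z.im ≠ 0 ∨ z.re ∈ Δ}, ‖g k z‖ ≤ M)
    (hpos : ∀ k, ∀ z : ℂ, 0 < z.im → 0 ≤ (g k z).im)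
    (hlim : ∀ x ∈ D, Tendsto (fun k => g k x) atTop (𝓝 (f x))) :
    ∃ G : ℂ → ℂ, DifferentiableOn ℂ G {z : ℂ | z.im ≠ 0 ∨ z.re ∈ Δ} ∧
      (∀ z : ℂ, 0 < z.im → 0 ≤ (G z).im) ∧ ∀ x ∈ Δ, G x = f x := by
  set U : Set ℂ := {z : ℂ | z.im ≠ 0 ∨ z.re ∈ Δ} with hU
  have hUo : IsOpen U := isOpen_pickDomain hΔ
  obtain ⟨G, φ, hφ, hGd, hGlim, -⟩ :=
    Complex.exists_strictMono_tendstoLocallyUniformlyOn_deriv hUo hg hb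
  refine ⟨G, hGd, ?_, ?_⟩
  · intro z hz
    have hzU : z ∈ U := Or.inl hz.ne'
    have ht : Tendsto (fun k => (g (φ k) z).im) atTop (𝓝 (G z).im) :=
      (Complex.continuous_im.tendsto _).comp (hGlim.tendsto_at hzU)
    exact ge_of_tendsto' ht fun k => hpos _ z hz
  · have hD : ∀ x ∈ D, G x = f x := by
      intro x hx
      have hxU : (x : ℂ) ∈ U := Or.inr (by simpa using hDΔ hx)
      have h1 : Tendsto (fun k => g (φ k) x) atTop (𝓝 (G x)) := hGlim.tendsto_at hxU
      have h2 : Tendsto (fun k => g (φ k) x) atTop (𝓝 (f x)) :=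
        (hlim x hx).comp hφ.tendsto_atTop
      exact tendsto_nhds_unique h1 h2
    intro x hx
    have hGc : ContinuousOn (fun t : ℝ => G t) Δ := by
      refine (hGd.continuousOn.comp Complex.continuous_ofReal.continuousOn ?_)
      intro t ht
      exact Or.inr (by simpa using ht)
    -- points of `D` on either side of `x`, arbitrarily close
    obtain ⟨η, hη, hηΔ⟩ := Metric.isOpen_iff.mp hΔ x hx
    have hnear : ∀ δ > 0, (∃ y ∈ D, x < y ∧ dist y x < δ) ∧ ∃ y ∈ D, y < x ∧ dist y x < δ := by
      intro δ hδ
      set δ' := min δ η with hδ'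
      have hδ'0 : 0 < δ' := lt_min hδ hη
      constructor
      · have hmem : x + δ' / 2 ∈ Δ := hηΔ (by
          rw [Metric.mem_ball, Real.dist_eq, add_sub_cancel_left, abs_of_pos (by positivity)]
          linarith [min_le_right δ η])
        obtain ⟨y, hyD, hyx⟩ := Metric.mem_closure_iff.mp (hdense hmem) (δ' / 2) (by positivity)
        rw [Real.dist_eq, abs_lt] at hyx
        refine ⟨y, hyD, by linarith [hyx.1], ?_⟩
        rw [Real.dist_eq, abs_lt]
        constructor <;> linarith [hyx.1, hyx.2, min_le_left δ η]
      · have hmem : x - δ' / 2 ∈ Δ := hηΔ (by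
          rw [Metric.mem_ball, Real.dist_eq, sub_sub_cancel_left, abs_neg, abs_of_pos (by positivity)]
          linarith [min_le_right δ η])
        obtain ⟨y, hyD, hyx⟩ := Metric.mem_closure_iff.mp (hdense hmem) (δ' / 2) (by positivity)
        rw [Real.dist_eq, abs_lt] at hyx
        refine ⟨y, hyD, by linarith [hyx.2], ?_⟩
        rw [Real.dist_eq, abs_lt]
        constructor <;> linarith [hyx.1, hyx.2, min_le_left δ η]
    -- closeness: for every `ε > 0`, `|re (G x) - f x| ≤ ε` and `|im (G x)| < ε`
    have key : ∀ ε > 0, |(G x).re - f x| ≤ ε ∧ |(G x).im| < ε := by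
      intro ε hε
      obtain ⟨δ, hδ, hδ'⟩ := Metric.continuousWithinAt_iff.mp (hGc x hx) ε hε
      obtain ⟨⟨y₁, hy₁D, hxy₁, hy₁⟩, ⟨y₂, hy₂D, hy₂x, hy₂⟩⟩ := hnear δ hδ
      have e1 : dist (G y₁) (G x) < ε := hδ' (hDΔ hy₁D) hy₁
      have e2 : dist (G y₂) (G x) < ε := hδ' (hDΔ hy₂D) hy₂
      rw [hD y₁ hy₁D] at e1
      rw [hD y₂ hy₂D] at e2
      rw [dist_eq_norm] at e1 e2
      have r1 := Complex.abs_re_le_norm ((f y₁ : ℂ) - G x)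
      have i1 := Complex.abs_im_le_norm ((f y₁ : ℂ) - G x)
      have r2 := Complex.abs_re_le_norm ((f y₂ : ℂ) - G x)
      simp only [Complex.sub_re, Complex.ofReal_re, Complex.sub_im, Complex.ofReal_im,
        zero_sub, abs_neg] at r1 i1 r2
      have m1 : f x ≤ f y₁ := hf hx (hDΔ hy₁D) hxy₁.le
      have m2 : f y₂ ≤ f x := hf (hDΔ hy₂D) hx hy₂x.le
      have r1' := abs_le.mp (r1.trans e1.le)
      have r2' := abs_le.mp (r2.trans e2.le)
      exact ⟨abs_le.mpr ⟨by linarith [r1'.1, r1'.2, r2'.1, r2'.2],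
        by linarith [r1'.1, r1'.2, r2'.1, r2'.2]⟩, lt_of_le_of_lt i1 e1⟩
    have hre : (G x).re = f x := by
      by_contra h
      have hpos' : 0 < |(G x).re - f x| := abs_pos.mpr (sub_ne_zero.mpr h)
      have := (key (|(G x).re - f x| / 2) (by positivity)).1
      linarith
    have him : (G x).im = 0 := by
      by_contra h
      have hpos' : 0 < |(G x).im| := abs_pos.mpr h
      have := (key |(G x).im| hpos').2
      exact lt_irrefl _ this
    apply Complex.ext
    · simpa using hre
    · simpa using him

/-! ### Local boundedness of the atoms `z/(1 - λ z)` on the slit domain of `(-1,1)` -/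

/-- `1 - λ z ≠ 0` for `|λ| ≤ 1` and `z` in the slit domain of `(-1,1)`. [folklore] -/
theorem one_sub_mul_ne_zero_of_mem_pickDomain {t : ℝ} (ht : |t| ≤ 1) {z : ℂ}
    (hz : z ∈ {z : ℂ | z.im ≠ 0 ∨ z.re ∈ Ioo (-1 : ℝ) 1}) : (1 : ℂ) - t * z ≠ 0 := by
  intro h
  have hre := congrArg Complex.re h
  have him := congrArg Complex.im h
  simp only [Complex.sub_re, Complex.one_re, Complex.mul_re, Complex.ofReal_re, Complex.ofReal_im,
    zero_mul, sub_zero, Complex.zero_re, Complex.sub_im, Complex.one_im, Complex.mul_im, add_zero,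
    zero_sub, Complex.zero_im, neg_eq_zero, mul_eq_zero] at hre him
  rcases hz with hz | hz
  · rcases him with him | him
    · subst him; simp at hre
    · exact hz him
  · -- `z` real with `|re z| < 1` and `t re z = 1`, `|t| ≤ 1`: impossible
    have h1 : t * z.re = 1 := by linarith
    have h2 : |t * z.re| < 1 := by
      rw [abs_mul]
      have hzre : |z.re| < 1 := abs_lt.mpr ⟨hz.1, hz.2⟩
      calc |t| * |z.re| ≤ 1 * |z.re| := by gcongr
        _ < 1 := by linarith
    rw [h1, abs_one] at h2
    exact lt_irrefl _ h2

/-- **Uniform local bound for the atoms.** On a compact subset `K` of the slit domain of `(-1,1)`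
the atoms `z/(1 - λz)`, `|λ| ≤ 1`, are bounded uniformly in `λ`. [folklore] -/
theorem exists_bound_atom_of_isCompact {K : Set ℂ} (hK : IsCompact K)
    (hKU : K ⊆ {z : ℂ | z.im ≠ 0 ∨ z.re ∈ Ioo (-1 : ℝ) 1}) :
    ∃ M : ℝ, ∀ t : ℝ, |t| ≤ 1 → ∀ z ∈ K, ‖z / (1 - t * z)‖ ≤ M := by
  -- the continuous function `(t, z) ↦ ‖z / (1 - t z)‖` on the compact `[-1,1] × K`
  have hc : ContinuousOn (fun p : ℝ × ℂ => ‖p.2 / (1 - p.1 * p.2)‖) (Icc (-1 : ℝ) 1 ×ˢ K) := by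
    refine ContinuousOn.norm (ContinuousOn.div (by fun_prop) (by fun_prop) ?_)
    rintro ⟨t, z⟩ ⟨ht, hz⟩
    exact one_sub_mul_ne_zero_of_mem_pickDomain (abs_le.mpr ⟨by linarith [ht.1], ht.2⟩) (hKU hz)
  obtain ⟨M, hM⟩ := (isCompact_Icc.prod hK).bddAbove_image hc
  refine ⟨M, fun t ht z hz => hM ⟨(t, z), ⟨⟨by linarith [(abs_le.mp ht).1], (abs_le.mp ht).2⟩, hz⟩,
    rfl⟩⟩

/-- Local boundedness, in the form required by Montel's theorem, of a family of functions on the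
slit domain of `(-1,1)` each of which is bounded by `A + B · sup_{|λ|≤1} |z/(1-λz)|` (e.g. sums
`a + b ∑ cᵢ z/(1 - λᵢ z)` with `|a| ≤ A`, `0 ≤ b ≤ B`, `cᵢ ≥ 0`, `∑ cᵢ = 1`). [folklore] -/
theorem locallyBounded_of_atom_bound {ι : Type*} {g : ι → ℂ → ℂ} {A B : ℝ}
    (hg : ∀ i, ∀ z ∈ {z : ℂ | z.im ≠ 0 ∨ z.re ∈ Ioo (-1 : ℝ) 1}, ∀ M : ℝ,
      (∀ t : ℝ, |t| ≤ 1 → ‖z / (1 - t * z)‖ ≤ M) → ‖g i z‖ ≤ A + B * M) :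
    ∀ a ∈ {z : ℂ | z.im ≠ 0 ∨ z.re ∈ Ioo (-1 : ℝ) 1}, ∃ M : ℝ, ∃ r > 0, ∀ i,
      ∀ z ∈ ball a r ∩ {z : ℂ | z.im ≠ 0 ∨ z.re ∈ Ioo (-1 : ℝ) 1}, ‖g i z‖ ≤ M := by
  intro a ha
  have hUo : IsOpen {z : ℂ | z.im ≠ 0 ∨ z.re ∈ Ioo (-1 : ℝ) 1} := isOpen_pickDomain isOpen_Ioo
  obtain ⟨r, hr, hrU⟩ := Metric.isOpen_iff.mp hUo a ha
  -- work on the compact closed ball of radius `r/2`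
  have hsub : closedBall a (r / 2) ⊆ {z : ℂ | z.im ≠ 0 ∨ z.re ∈ Ioo (-1 : ℝ) 1} :=
    (closedBall_subset_ball (by linarith)).trans hrU
  obtain ⟨M, hM⟩ := exists_bound_atom_of_isCompact (isCompact_closedBall a (r / 2)) hsub
  refine ⟨A + B * M, r / 2, by positivity, fun i z hz => ?_⟩
  exact hg i z hz.2 M fun t ht => hM t ht z (ball_subset_closedBall hz.1)

end Literature.Analysis.Complex
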